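/-
COR-CM (cells pub-hodgecm / pub-hodgecm2) — Δ2 BRIDGE, S1 AT THE PIN UNDER THE CONJUGATE INSTANCE, READ AT THE OLD KEY (seat
prover-pub-hodgecm2-d2bridge-wb-2-g0-0, wall-breaker 2).  ῑ₁ := (starRingEnd ℂ).comp ι₁.  The primed twin
`HcmS1PinJunctionConj.exists_dLiu_of_objOne_conj` states its admissibility in the ῑ₁-reading `IsReflexOfTypeG ῑ₁ Φ_μ` (the re-keyed
dictionary's `adm′`); THIS FILE is the one-rewrite corollary reading it at the OLD key through the landed seam lemma
`ReflexOfTypeConj.isReflexOfTypeG_conj_iff`: `IsReflexOfTypeG ι₁ Φ̄_μ`, `Φ̄_μ = HodgeCM.CMTypeOps.bar Φ_μ` (= `Φ_{μ^c}`, [Liu2021] Remark 4.4).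
Theorems only; nothing landed is edited or restated.  HC_CM is NOT proved; «Δ2 BRIDGE CLOSED» is NOT claimed.
-/
import Summits.HodgeConjecture.CorCM.D2Bridge.HcmS1PinJunctionConj
import Summits.HodgeConjecture.CorCM.D2Bridge.ReflexOfTypeConj
import HarnessLib

set_option autoImplicit false

/-!
# Δ2 bridge, S1 at the pin under `ῑ₁`, read at the old key: admissibility for the conjugate type `Φ̄_μ`

* `exists_dLiu_of_objOne_conj_bar` — `∃ dLiu u, (∀ Φ' = Φ̄_μ, ∀ q, (dLiu q).IsReflexOfTypeG ι₁ Φ') ∧ (∀ Φ' = Φ_μ, ∀ q,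
  (dLiu q).IsReflexOfTypeG ῑ₁ Φ') ∧ ∀ q Y f, (f ≫ u q)^*_ℂ (dLiu q).α = (q : ℂ) • f^*_ℂ α₀`.

References: Y. Liu, arXiv:2102.11518 = Camb. J. Math. 9 (2021), Def. 4.3 (2), Remark 4.4, Def. 4.5 (2), proof of Thm. 4.18.  HC_CM is NOT proved.
-/

noncomputable section

open scoped TensorProduct

namespace Summit.HodgeConjecture.CorCM.D2Bridge

open CategoryTheory NumberField
open Literature.AlgebraicGeometry.Motives Literature.AlgebraicGeometry.HodgeTheory
open Literature.NumberTheory.ComplexMultiplication Literature.NumberTheory.Automorphic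
open Literature.NumberTheory.Automorphic.IdeleClassGroup Literature.NumberTheory.Automorphic.PicardCM
open Literature.NumberTheory.Automorphic.Liu2021 Literature.NumberTheory.Automorphic.Liu2021.AppendixC.RestOne
open HodgeCM.Model (LiuCMSide)

section Junction

variable {L : HodgeCM.CMField} [IsGalois ℚ L] (ι₁ : L →+* ℂ)
  {μ : Literature.NumberTheory.Automorphic.IdeleClassGroup L →ₜ* Circle} (hμ : IsConjugateSymplectic L μ)
  (hw : HasWeight L μ 1) (Car : Def45.Carriers L μ)

/-- **S1 junction under `ῑ₁`, both readings**: the primed twin `exists_dLiu_of_objOne_conj` with its admissibility ALSO read at the old key —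
`IsReflexOfTypeG ι₁ Φ̄_μ` for the conjugate type `Φ̄_μ = CMTypeOps.bar Φ_μ` (one rewrite with `ReflexOfTypeConj.isReflexOfTypeG_conj_iff`).
[cite: Liu2021, Def. 4.3 (2) (FJcycle.tex l. 1919), Remark 4.4 (l. 1930–1933), Def. 4.5 (2) (l. 1944–1951), proof of Thm. 4.18 (l. 2246–2253)] -/
theorem exists_dLiu_of_objOne_conj_bar [inst : Algebra (L : Type) ℂ]
    (hinst : ∀ x : L, algebraMap (L : Type) ℂ x = ((starRingEnd ℂ).comp ι₁) x)
    (D : ObjOne (AlgHom.id ℚ L) ι₁ hμ hw Car)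
    (α₀ : ℂ ⊗[ℚ] bettiCohomology (AμC (AlgHom.id ℚ L) ι₁ hμ hw Car D).X 1)
    (hα₀ : letI := lineModuleOne (AlgHom.id ℚ L) ι₁ hμ hw Car D
      ∀ s : fieldOfValues L μ,
        (DistribSMul.toLinearMap ℚ (bettiCohomology (AμC (AlgHom.id ℚ L) ι₁ hμ hw Car D).X 1) s).baseChange ℂ α₀ =
          algebraMap (fieldOfValues L μ) ℂ s • α₀)
    (hα₀0 : α₀ ≠ 0) :
    ∃ (dLiu : ℚ → LiuCMSide) (u : ∀ q : ℚ, (AμC (AlgHom.id ℚ L) ι₁ hμ hw Car D).X ⟶ (dLiu q).A.X),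
      (∀ Φ' : CMType L, HodgeCM.CMTypeOps.bar hμ.cmType = Φ' → ∀ q : ℚ, (dLiu q).IsReflexOfTypeG ι₁ Φ') ∧
      (∀ Φ' : CMType L, hμ.cmType = Φ' → ∀ q : ℚ, (dLiu q).IsReflexOfTypeG ((starRingEnd ℂ).comp ι₁) Φ') ∧
      ∀ (q : ℚ) (Y : SchemeOver ℂ) (f : Y ⟶ (AμC (AlgHom.id ℚ L) ι₁ hμ hw Car D).X),
        (BettiUniverse.pull (f ≫ u q) 1).baseChange ℂ (dLiu q).α = (q : ℂ) • (BettiUniverse.pull f 1).baseChange ℂ α₀ := by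
  obtain ⟨dLiu, u, hb, hlaw⟩ := exists_dLiu_of_objOne_conj ι₁ hμ hw Car hinst D α₀ hα₀ hα₀0
  refine ⟨dLiu, u, ?_, hb, hlaw⟩
  rintro Φ' rfl q
  exact (isReflexOfTypeG_conj_iff ι₁ _ hμ.cmType).1 (hb hμ.cmType rfl q)

end Junction

end Summit.HodgeConjecture.CorCM.D2Bridge

end
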